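import Literature.NumberTheory.Automorphic.HyperspecialUnitaryCompactOpen          -- ★ `isOpen_unitaryInt` (`K₀` open ⇒ measurable)
import Summits.HodgeConjecture.HodgeConjecture.Theorems.R90S6ConstantTermSatakeCoeff   -- ★ (B1) p864012 `integral_coeff_toVector_mul_eq` (Cartier's formula in U(σ,J₀)(K)), `iwasawaExp_mul_of_mem_normalizer`; brings ★ `heckeAlgebra.toVector`, `unipotentU`, `satakeTransform`
import Mathlib.MeasureTheory.Integral.Prod
import Mathlib.MeasureTheory.Group.Measure
import HarnessLib

/-!
# R90 · S6 «Ch. 14.1–14.5 stable trace formula» — CARD B2a (row E1.3.6.2): CONSTANT-TERM TRANSPORT THROUGH A BOREL-COMPATIBLE FRAME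
# `∫_{K₃×N} φ(E(k(tn)k⁻¹)) = κ(K₃) · ∫_N φ(E(tn))`, `∫_N φ(E(tn)) dμ_N = ∫_{N′} φ((Et)·u) d(E|_N)_*μ_N`, and CARTIER's value (`Theorems/R90S6ConstantTermTransport.lean`)

Dealer R90-C14-plan (g2), RULING F5-R1 2026-09-05T01:10:47Z («(B2a) TRANSPORT → p01, the measure push-forward half of p09's (B2) cut»), CARD B2a 01:13:19Z, p09 (g0)'s
HAND-OVER CENSUS 01:15:44Z adopted as the letter 01:15:59Z («state (T.1)(T.2) for a GENERIC `E` with the K-law and N-law as binders — so the eG-independence row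
E1.3.9.1 is not re-entered —, instantiate at `localNonsplitEquiv` in a closing § only»).  THIS FILE = the generic transport + Cartier's value through the frame;
the VALUES `Φ_G(⟦e t⟧, φ∘eG) = νG(K′)·J₃(t)·Q^m·(𝒮₃ φ).coeff ℓ_m` (★ `classOrbitalIntegral_eq_smul_integral_prod_of_torus_regular` + this file) and the instantiation
at ★ `localNonsplitEquiv` are the sequel `Theorems/R90S6ConstantTermTransportValue.lean`.

THE OBJECTS.  `G` (the Levi-side group, e.g. `U(Φ₃)(L⁺_v)`) and `G′` (the Hecke-side group, `U(σ, J₀)(K) = unitaryGroupOfForm σ ((StdForm.antidiagonal M).over K)`)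
topological groups with Borel σ-algebras; `E : G ≃ₜ* G′` (or any monoid-hom-like map for (T.1)) a FRAME with the K-LAW `E g ∈ K₀ ↔ g ∈ K₃` (`K₃ ≤ G`,
`K₀ = unitaryInt ≤ G′`) and the N-LAW `g ∈ N ↔ E g ∈ N′` (`N ≤ G` the Levi-side unipotent radical, `N′ = unipotentU σ J₀`); `EN : ↥N ≃ₜ* ↥N′` ANY restriction of `E`
(binder `hEN : ↑(EN n) = E ↑n`; e.g. ★ `ContinuousMulEquiv.restrictSubgroup E N N′ hN`); `κ` a measure on `↥K₃`, `μ_N` on `↥N`; the test function of `T ∈ ℋ(G′, K₀)` is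
`g′ ↦ (toVector K₀ T).coeff (g′K₀)` (= `heckeToFun K₀ T g′` of the S6 socket `R90_S6_FloorE1D` by `rfl`).

* §1 (any groups, any `k`) `mk_conj_mem_orbit` · **`coeff_toVector_conj`** (`T[K₀](k g k⁻¹) = T[K₀](g)` for `k ∈ K₀` — left `K₀`-invariance ★ `ofMulAction_toVector` +
  right `K₀`-invariance of the coset, ★ `coeff_eq_of_mem_orbit`) · `coeff_toVector_map_conj` (through a hom `E` with `E(K₃) ⊆ K₀`).
* §2 (T.1) **`integral_prod_conj_eq_mul`** (any `f` conjugation-invariant under `K₃`: `∫_{K₃×N} f(k(tn)k⁻¹) d(κ⊗μ_N) = κ(K₃) · ∫_N f(tn) dμ_N`, Mathlib `integral_fun_snd`)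
  and its Hecke form **`integral_prod_coeff_toVector_conj_eq_mul`** (p09's (T.1) letters).
* §3 (T.2) **`integral_comp_frame_mul_eq_integral_map`** (`∫_N f(E(t·n)) dμ_N = ∫_{N′} f(E t · u) d(EN_* μ_N)`, Mathlib `integral_map_equiv`), `map_frame_apply_setOf_mem`
  (the `N′₀`-mass: `(EN_* μ_N){u | ↑u ∈ K₀} = μ_N {n | ↑n ∈ K₃}` under the K-law), `isMulLeftInvariant_map_frame` (left-invariance is transported), `map_mem_normalizer_of_frame`
  (`t ∈ N_G(N) ⇒ E t ∈ N_{G′}(N′)` under the N-law).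
* §4 CARTIER THROUGH THE FRAME **`integral_prod_coeff_toVector_frame_eq`**: for `t` normalising `N`,
  `∫_{K₃×N} T[K₀](E(k(tn)k⁻¹)) d(κ⊗μ_N) = κ(K₃) · μ_N(N ∩ K₃) · (q^{−⟨ν,a(Et)⟩∕2})⁻¹ · 𝒮(T)_{a(E t)}` (§2 + §3 + ★ (B1) `integral_coeff_toVector_mul_eq`), and the
  `N`-only form `integral_coeff_toVector_frame_mul_eq`.

Cell `hodgecm-mathlib`, crux H413 (`stmt-HodgeConjecture-24833`), route of record `HCCMUnconditional`; programme R90-TF (brief `director/R90-BRIEF.v2.md` 1f40d54518340a35),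
section S6 (base `R90-C14`), seat R90-C14-p01 (g2).  Lane `--kind proof --supports stmt-HodgeConjecture-24833 --as helper`; THEOREMS ONLY (no definition, no instance, no notation,
no named fact, no kit, no `sorry`); imports ★ (B1) `Theorems/R90S6ConstantTermSatakeCoeff` + Mathlib product∕Haar measure + HarnessLib; never `Lines/`.
HONEST LABEL: measure push-forward bookkeeping, count-neutral until (B2d) `R90S6HyperbolicHeckeFL` consumes it; proves no printed global statement, discharges no citation;
HC_CM is proved only modulo the 7 printed citations (2 remaining named inputs: hLiu418 = stmt-HodgeConjecture-24832, h413 = stmt-HodgeConjecture-24833) until rung 0 closes.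

## References
* [CartierCorvallis1979] P. Cartier, *Representations of 𝔭-adic groups: a survey*, PSPM 33.1 (1979): §IV (4.2) p. 146 (`(Sf)(m) = δ(m)^{1∕2} ∫_N f(mn) dn`), Thm. 4.1.
* [Rogawski1990] J. D. Rogawski, *Automorphic Representations of Unitary Groups in Three Variables*, Ann. of Math. Stud. 123 (1990): §4.9 (4.9.2) p. 55 («`Φ(γ, f) = |D(γ)|⁻¹ f^{(B)}(γ)`»),
  Lemma 4.9.2 pp. 55–56; §4.13 p. 70 («`dg = dk dm du`»); §4.3 (4.3.1) p. 43.
* [DeitmarEchterhoff2014] A. Deitmar, S. Echterhoff, *Principles of Harmonic Analysis*, 2nd ed. (2014): Thm. 1.5.3 (push-forward of Haar measures along isomorphisms).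
-/

set_option autoImplicit false
-- the mandated namespace repeats the single-problem summit's segment (`HodgeConjecture.HodgeConjecture`)
set_option linter.dupNamespace false

noncomputable section

open MeasureTheory Measure Set Function
open scoped ENNReal Pointwise Valued WithZero Matrix MatrixGroups
open MulAction
open Literature.NumberTheory.Automorphic Literature.NumberTheory.Automorphic.HermitianLattice Literature.NumberTheory.Automorphic.heckeAlgebra
  Literature.NumberTheory.Automorphic.UnitaryGroup Literature.NumberTheory.Automorphic.HermitianLattice.UnramifiedLocalConjDatum

namespace Summit.HodgeConjecture.HodgeConjecture.R90.S6

/-! ## §1 `T[K₀]` is invariant under conjugation by `K₀` -/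

section Conj

variable {k G : Type*} [CommRing k] [Group G] (K : Subgroup G)

/-- For `a ∈ K`, the coset of `a g a⁻¹` lies in the `K`-orbit of the coset of `g` in `G ⧸ K` (it is `a • gK`). [cite: CartierCorvallis1979, §IV Thm. 4.1] -/
theorem mk_conj_mem_orbit {a : G} (ha : a ∈ K) (g : G) :
    ((a * g * a⁻¹ : G) : G ⧸ K) ∈ MulAction.orbit K (g : G ⧸ K) := by
  have h1 : ((a * g * a⁻¹ : G) : G ⧸ K) = ((a * g : G) : G ⧸ K) :=
    QuotientGroup.eq.2 (by rw [show (a * g * a⁻¹)⁻¹ * (a * g) = a by group]; exact ha)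
  rw [h1]
  exact MulAction.mem_orbit_iff.2 ⟨⟨a, ha⟩, rfl⟩

/-- **`T[K](a g a⁻¹) = T[K](g)` for `a ∈ K`**: the coset function of a Hecke-algebra element is invariant under conjugation by `K` (left `K`-invariance of `T[K]`,
★ `ofMulAction_toVector`, along the `K`-orbit `mk_conj_mem_orbit`, ★ `coeff_eq_of_mem_orbit`). [cite: CartierCorvallis1979, §IV Thm. 4.1] -/
theorem coeff_toVector_conj (T : heckeAlgebra k G K) {a : G} (ha : a ∈ K) (g : G) :
    (toVector K T).coeff ((a * g * a⁻¹ : G) : G ⧸ K) = (toVector K T).coeff (g : G ⧸ K) :=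
  coeff_eq_of_mem_orbit K (fun _ hb => ofMulAction_toVector K T hb) (mk_conj_mem_orbit K ha g)

/-- **Through a frame**: for a monoid-hom-like `E : G₁ → G` with `E(K₁) ⊆ K` and `a ∈ K₁`, `T[K](E(a g a⁻¹)) = T[K](E g)`. [cite: CartierCorvallis1979, §IV Thm. 4.1] -/
theorem coeff_toVector_map_conj {G₁ F : Type*} [Group G₁] [FunLike F G₁ G] [MonoidHomClass F G₁ G] (E : F) {K₁ : Subgroup G₁}
    (hEK : ∀ a ∈ K₁, E a ∈ K) (T : heckeAlgebra k G K) {a : G₁} (ha : a ∈ K₁) (g : G₁) :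
    (toVector K T).coeff ((E (a * g * a⁻¹) : G) : G ⧸ K) = (toVector K T).coeff ((E g : G) : G ⧸ K) := by
  rw [map_mul, map_mul, map_inv]
  exact coeff_toVector_conj K T (hEK a ha) (E g)

end Conj

/-! ## §2 (T.1): `∫_{K₃×N} f(k(tn)k⁻¹) d(κ⊗μ_N) = κ(K₃) · ∫_N f(tn) dμ_N` for `f` conjugation-invariant under `K₃` -/

section Fubini

variable {G : Type*} [Group G] (K₃ N : Subgroup G) [MeasurableSpace ↥K₃] [MeasurableSpace ↥N]
  (κ : Measure ↥K₃) (μN : Measure ↥N) [SFinite κ] [SFinite μN]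

/-- **(T.1), function form**: if `f : G → ℂ` satisfies `f(a g a⁻¹) = f g` for all `a ∈ K₃`, then for every `t ∈ G`,
`∫_{K₃×N} f(k (t n) k⁻¹) d(κ ⊗ μ_N) = κ(K₃) · ∫_N f(t n) dμ_N` (the integrand does not depend on `k`; Mathlib `integral_fun_snd`).  This is the «`dk`» integration of
[Rogawski1990 §4.13 p. 70] for a `K`-conjugation-invariant integrand. [cite: Rogawski1990, §4.13 p. 70; §4.3 (4.3.1) p. 43] -/
theorem integral_prod_conj_eq_mul (f : G → ℂ) (hf : ∀ a ∈ K₃, ∀ g : G, f (a * g * a⁻¹) = f g) (t : G) :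
    ∫ p : ↥K₃ × ↥N, f ((p.1 : G) * (t * (p.2 : G)) * (p.1 : G)⁻¹) ∂(κ.prod μN) = (κ Set.univ).toReal * ∫ n : ↥N, f (t * (n : G)) ∂μN := by
  have h : (fun p : ↥K₃ × ↥N => f ((p.1 : G) * (t * (p.2 : G)) * (p.1 : G)⁻¹)) = fun p : ↥K₃ × ↥N => f (t * (p.2 : G)) := by
    funext p
    exact hf p.1 p.1.2 _
  rw [h]
  have key := integral_fun_snd (μ := κ) (ν := μN) (fun n : ↥N => f (t * (n : G)))
  rw [key, Complex.real_smul]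
  rfl

/-- **(T.1), HECKE FORM (p09's letters)**: for a frame `E : G → G′` (monoid-hom-like) with `E(K₃) ⊆ K₀` and `T ∈ ℋ(G′, K₀)`,
`∫_{K₃×N} T[K₀](E(k (t n) k⁻¹)) d(κ ⊗ μ_N) = κ(K₃) · ∫_N T[K₀](E(t n)) dμ_N`. [cite: Rogawski1990, §4.13 p. 70] [cite: CartierCorvallis1979, §IV (4.2) p. 146] -/
theorem integral_prod_coeff_toVector_conj_eq_mul {G' F : Type*} [Group G'] [FunLike F G G'] [MonoidHomClass F G G'] (E : F)
    (K₀ : Subgroup G') (hEK : ∀ a ∈ K₃, E a ∈ K₀) (T : heckeAlgebra ℂ G' K₀) (t : G) :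
    ∫ p : ↥K₃ × ↥N, (toVector K₀ T).coeff ((E ((p.1 : G) * (t * (p.2 : G)) * (p.1 : G)⁻¹) : G') : G' ⧸ K₀) ∂(κ.prod μN) =
      (κ Set.univ).toReal * ∫ n : ↥N, (toVector K₀ T).coeff ((E (t * (n : G)) : G') : G' ⧸ K₀) ∂μN :=
  integral_prod_conj_eq_mul K₃ N κ μN (fun g => (toVector K₀ T).coeff ((E g : G') : G' ⧸ K₀))
    (fun _ ha g => coeff_toVector_map_conj K₀ E hEK T ha g) t

end Fubini

/-! ## §3 (T.2): push-forward along the frame restricted to the unipotent radical -/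

section PushForward

variable {G G' : Type*} [Group G] [Group G'] [TopologicalSpace G] [TopologicalSpace G'] [IsTopologicalGroup G] [IsTopologicalGroup G']
  [MeasurableSpace G] [BorelSpace G] [MeasurableSpace G'] [BorelSpace G']
  (E : G ≃ₜ* G') {N : Subgroup G} {N' : Subgroup G'} (EN : ↥N ≃ₜ* ↥N') (hEN : ∀ n : ↥N, ((EN n : ↥N') : G') = E (n : G))
  (μN : Measure ↥N)

omit [IsTopologicalGroup G] [IsTopologicalGroup G'] in
include hEN in
/-- **(T.2)**: for any restriction `EN : ↥N ≃ₜ* ↥N′` of the frame `E` (`↑(EN n) = E ↑n`), any `f : G′ → ℂ` and `t ∈ G`,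
`∫_N f(E(t·n)) dμ_N = ∫_{N′} f(E t · u) d(EN_* μ_N)` (change of variables along the measurable equivalence `EN`, Mathlib `integral_map_equiv`; `E(tn) = E t · E n`).
[cite: DeitmarEchterhoff2014, Thm. 1.5.3] [cite: Rogawski1990, §4.3 (4.3.1) p. 43] -/
theorem integral_comp_frame_mul_eq_integral_map (f : G' → ℂ) (t : G) :
    ∫ n : ↥N, f (E (t * (n : G))) ∂μN = ∫ u : ↥N', f (E t * (u : G')) ∂(Measure.map EN μN) := by
  rw [show (EN : ↥N → ↥N') = EN.toHomeomorph.toMeasurableEquiv from rfl, integral_map_equiv]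
  refine integral_congr_ae (Filter.Eventually.of_forall fun n => ?_)
  change f (E (t * (n : G))) = f (E t * ((EN n : ↥N') : G'))
  rw [hEN, map_mul]

omit [IsTopologicalGroup G] [IsTopologicalGroup G'] in
include hEN in
/-- **The mass of `N′₀ = N′ ∩ K₀`**: under the K-law `E g ∈ K₀ ↔ g ∈ K₃` and for `K₀` measurable, `(EN_* μ_N){u | ↑u ∈ K₀} = μ_N{n | ↑n ∈ K₃}`.
[cite: DeitmarEchterhoff2014, Thm. 1.5.3] -/
theorem map_frame_apply_setOf_mem {K₃ : Subgroup G} {K₀ : Subgroup G'} (hEK : ∀ g : G, E g ∈ K₀ ↔ g ∈ K₃) (hK₀ : MeasurableSet (K₀ : Set G')) :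
    Measure.map EN μN {u : ↥N' | (u : G') ∈ K₀} = μN {n : ↥N | (n : G) ∈ K₃} := by
  have hm : Measurable (EN : ↥N → ↥N') := EN.continuous.measurable
  have hs : MeasurableSet {u : ↥N' | (u : G') ∈ K₀} := measurable_subtype_coe hK₀
  rw [Measure.map_apply hm hs]
  congr 1
  ext n
  simp only [Set.mem_preimage, Set.mem_setOf_eq, hEN, hEK]

/-- **Left-invariance is transported**: if `μ_N` is left-invariant then so is `EN_* μ_N` (Mathlib `isMulLeftInvariant_map` for the surjective measurable hom `EN`).
[cite: DeitmarEchterhoff2014, Thm. 1.5.3] -/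
theorem isMulLeftInvariant_map_frame [μN.IsMulLeftInvariant] : (Measure.map EN μN).IsMulLeftInvariant :=
  isMulLeftInvariant_map EN.toMulEquiv.toMonoidHom.toMulHom EN.continuous.measurable EN.surjective

omit [TopologicalSpace G] [TopologicalSpace G'] [IsTopologicalGroup G] [IsTopologicalGroup G'] [MeasurableSpace G] [BorelSpace G] [MeasurableSpace G']
  [BorelSpace G'] in
/-- **The N-law transports normalisers**: if `g ∈ N ↔ E g ∈ N′` for all `g` (`E` a group isomorphism), then `t ∈ N_G(N) ⇒ E t ∈ N_{G′}(N′)`.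
[cite: CartierCorvallis1979, §IV (4.2)] -/
theorem map_mem_normalizer_of_frame {F : Type*} [EquivLike F G G'] [MulEquivClass F G G'] (e : F) (hN : ∀ g : G, g ∈ N ↔ e g ∈ N') {t : G}
    (ht : t ∈ Subgroup.normalizer (N : Set G)) : e t ∈ Subgroup.normalizer (N' : Set G') := by
  rw [Subgroup.mem_normalizer_iff] at ht ⊢
  intro u
  obtain ⟨g, rfl⟩ := EquivLike.surjective e u
  rw [← map_inv, ← map_mul, ← map_mul, ← hN, ← hN]
  exact ht g

end PushForward

/-! ## §4 Cartier's formula through the frame: `∫_{K₃×N} T[K₀](E(k(tn)k⁻¹)) = κ(K₃) · μ_N(N ∩ K₃) · (q^{−⟨ν,a(Et)⟩∕2})⁻¹ · 𝒮(T)_{a(Et)}` -/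

section Cartier

variable {K : Type*} [Field K] [Valued K ℤᵐ⁰] {σ : K →+* K} {ϖ : K} {M : ℕ}
  [MeasurableSpace (unitaryGroupOfForm σ ((StdForm.antidiagonal M).over K))] [BorelSpace (unitaryGroupOfForm σ ((StdForm.antidiagonal M).over K))]
  {G : Type*} [Group G] [TopologicalSpace G] [IsTopologicalGroup G] [MeasurableSpace G] [BorelSpace G]
  (E : G ≃ₜ* unitaryGroupOfForm σ ((StdForm.antidiagonal M).over K)) {N K₃ : Subgroup G}
  (hN : ∀ g : G, g ∈ N ↔ E g ∈ unipotentU σ ((StdForm.antidiagonal M).over K))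
  (hEK : ∀ g : G, E g ∈ unitaryInt σ ((StdForm.antidiagonal M).over K) ↔ g ∈ K₃)
  (EN : ↥N ≃ₜ* ↥(unipotentU σ ((StdForm.antidiagonal M).over K)))
  (hEN : ∀ n : ↥N, ((EN n : ↥(unipotentU σ ((StdForm.antidiagonal M).over K))) : unitaryGroupOfForm σ ((StdForm.antidiagonal M).over K)) = E (n : G))
  (μN : Measure ↥N) [μN.IsMulLeftInvariant]
include hN hEK hEN

/-- **CARTIER THROUGH THE FRAME, `N`-form**: for `hd : UnramifiedLocalConjDatum σ ϖ`, finite residue field, a frame `E : G ≃ₜ* U(σ,J₀)(K)` with the N-law and the K-law,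
`T ∈ ℋ(U(σ,J₀), K₀)`, `t ∈ N_G(N)`, and a left-invariant `μ_N` on `↥N` with `μ_N(N ∩ K₃) < ∞`:
`∫_N T[K₀](E(t·n)) dμ_N = μ_N(N ∩ K₃) · (q^{−⟨ν,a(E t)⟩∕2})⁻¹ · 𝒮(T)_{a(E t)}` — (T.2) + ★ (B1) `integral_coeff_toVector_mul_eq` on `U(σ,J₀)` for the transported measure
`EN_* μ_N` (left-invariant §3, `N′₀`-mass §3; `E t` normalises `N′` §3; `K₀` is open ★ `isOpen_unitaryInt`, hence measurable).
[cite: CartierCorvallis1979, §IV (4.2) p. 146] [cite: Rogawski1990, §4.9 (4.9.2) p. 55] -/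
theorem integral_coeff_toVector_frame_mul_eq (hd : UnramifiedLocalConjDatum σ ϖ) [Finite 𝓀[K]]
    (T : heckeAlgebra ℂ (unitaryGroupOfForm σ ((StdForm.antidiagonal M).over K)) (unitaryInt σ ((StdForm.antidiagonal M).over K)))
    {t : G} (ht : t ∈ Subgroup.normalizer (N : Set G)) (hfin : μN {n : ↥N | (n : G) ∈ K₃} ≠ ∞) :
    ∫ n : ↥N, (toVector (unitaryInt σ ((StdForm.antidiagonal M).over K)) T).coeff
        ((E (t * (n : G)) : unitaryGroupOfForm σ ((StdForm.antidiagonal M).over K)) :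
          unitaryGroupOfForm σ ((StdForm.antidiagonal M).over K) ⧸ unitaryInt σ ((StdForm.antidiagonal M).over K)) ∂μN =
      (μN {n : ↥N | (n : G) ∈ K₃}).toReal *
        ((satakeWeight (residueCardSqrt K) (hd.iwasawaExp (E t)))⁻¹ * (hd.satakeTransform T).coeff (hd.iwasawaExp (E t))) := by
  haveI : (Measure.map EN μN).IsMulLeftInvariant := isMulLeftInvariant_map_frame EN μN
  have hK₀ : MeasurableSet (unitaryInt σ ((StdForm.antidiagonal M).over K) : Set (unitaryGroupOfForm σ ((StdForm.antidiagonal M).over K))) :=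
    (isOpen_unitaryInt σ _).measurableSet
  have hN₀ : MeasurableSet {u : ↥(unipotentU σ ((StdForm.antidiagonal M).over K)) |
      (u : unitaryGroupOfForm σ ((StdForm.antidiagonal M).over K)) ∈ unitaryInt σ ((StdForm.antidiagonal M).over K)} :=
    measurable_subtype_coe hK₀
  have hmass := map_frame_apply_setOf_mem E EN hEN μN hEK hK₀
  have hfin' : Measure.map EN μN {u : ↥(unipotentU σ ((StdForm.antidiagonal M).over K)) |
      (u : unitaryGroupOfForm σ ((StdForm.antidiagonal M).over K)) ∈ unitaryInt σ ((StdForm.antidiagonal M).over K)} ≠ ∞ := by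
    rw [hmass]; exact hfin
  rw [integral_comp_frame_mul_eq_integral_map E EN hEN μN
      (fun g => (toVector (unitaryInt σ ((StdForm.antidiagonal M).over K)) T).coeff
        (g : unitaryGroupOfForm σ ((StdForm.antidiagonal M).over K) ⧸ unitaryInt σ ((StdForm.antidiagonal M).over K))) t,
    integral_coeff_toVector_mul_eq (Measure.map EN μN) hd T (map_mem_normalizer_of_frame E hN ht) hN₀ hfin', hmass]

variable [MeasurableSpace ↥K₃] (κ : Measure ↥K₃) [SFinite κ] [SFinite μN]

/-- **CARD B2a — CARTIER'S VALUE THROUGH THE FRAME, `K₃ × N`-form**: under the hypotheses of `integral_coeff_toVector_frame_mul_eq` and for any s-finite `κ` on `↥K₃`,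
`∫_{K₃×N} T[K₀](E(k (t n) k⁻¹)) d(κ ⊗ μ_N) = κ(K₃) · (μ_N(N ∩ K₃) · (q^{−⟨ν,a(E t)⟩∕2})⁻¹ · 𝒮(T)_{a(E t)})` — (T.1) ∘ (T.2) ∘ ★ (B1): the `K × N` integral of ★
`classOrbitalIntegral_eq_smul_integral_prod_of_torus_regular` at the test function `heckeToFun K₀ T ∘ E`, read as a Satake coefficient.
[cite: Rogawski1990, §4.9 (4.9.2) p. 55; §4.13 p. 70] [cite: CartierCorvallis1979, §IV (4.2) p. 146] -/
theorem integral_prod_coeff_toVector_frame_eq (hd : UnramifiedLocalConjDatum σ ϖ) [Finite 𝓀[K]]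
    (T : heckeAlgebra ℂ (unitaryGroupOfForm σ ((StdForm.antidiagonal M).over K)) (unitaryInt σ ((StdForm.antidiagonal M).over K)))
    {t : G} (ht : t ∈ Subgroup.normalizer (N : Set G)) (hfin : μN {n : ↥N | (n : G) ∈ K₃} ≠ ∞) :
    ∫ p : ↥K₃ × ↥N, (toVector (unitaryInt σ ((StdForm.antidiagonal M).over K)) T).coeff
        ((E ((p.1 : G) * (t * (p.2 : G)) * (p.1 : G)⁻¹) : unitaryGroupOfForm σ ((StdForm.antidiagonal M).over K)) :
          unitaryGroupOfForm σ ((StdForm.antidiagonal M).over K) ⧸ unitaryInt σ ((StdForm.antidiagonal M).over K)) ∂(κ.prod μN) =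
      (κ Set.univ).toReal * ((μN {n : ↥N | (n : G) ∈ K₃}).toReal *
        ((satakeWeight (residueCardSqrt K) (hd.iwasawaExp (E t)))⁻¹ * (hd.satakeTransform T).coeff (hd.iwasawaExp (E t)))) := by
  rw [integral_prod_coeff_toVector_conj_eq_mul K₃ N κ μN E (unitaryInt σ ((StdForm.antidiagonal M).over K)) (fun a ha => (hEK a).2 ha) T t,
    integral_coeff_toVector_frame_mul_eq E hN hEK EN hEN μN hd T ht hfin]

end Cartier

end Summit.HodgeConjecture.HodgeConjecture.R90.S6

end
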